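import Literature.AlgebraicGeometry.Milne1999.HodgeCMImpliesTateFiniteFields
import Literature.AlgebraicGeometry.Motives.ZetaFunction
import Mathlib.RingTheory.PowerSeries.WellKnown
import HarnessLib

/-!
# Kahn 2003: rational = numerical equivalence, and the order of the poles of the zeta function,
# for abelian varieties over finite fields satisfying the Tate conjecture

B. Kahn, *Équivalences rationnelle et numérique sur certaines variétés de type abélien sur un corps
fini*, Ann. Sci. École Norm. Sup. (4) **36** (2003) 977–1002 [KahnB2003RatNumAbelianType], read in
the held text `doi:10.1016/j.ansens.2003.02.002` (printed page numbers below). This file TYPES,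
at statement level and in the tree's vocabulary, Kahn's THÉORÈME 1 (= Thm. 1.10) and
COROLLAIRE 2.1 SPECIALISED TO ABELIAN VARIETIES, so that the edges
"HC for CM abelian varieties ⟹ (Milne 1999 Thm. 7.1) Tate for abelian varieties over finite
fields ⟹ (Kahn) on every abelian variety over every finite field rational and numerical
equivalence agree with `ℚ`-coefficients, the Chow groups have finite rank, and that rank is the
order of the pole of the zeta function" are kernel-visible
(`rationalEqNumerical_AV_Fq_of_HC_CM`, `zetaPoleOrder_AV_Fq_of_HC_CM`). Nothing of Kahn's proof
(Kimura finite-dimensionality, Jannsen's semisimplicity, André–Kahn) is formalised; the two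
printed theorems are `E`-parametrised cited PREDICATES (`Theoreme1 E`, `Corollaire21 E`) in the
standing of `Milne1999.Theorem71 E` — see "Lean rendering" below. The CONCLUSION of the pole-order edge
is intrinsic: it mentions only the point counts of `A` (through `Motives.zetaSeries`) and the Chow
groups of `A` (`Motives.ChowGroup`), no cohomology theory.

## The source, verbatim

* p. 977, display (∗) and the sentence after it: the `l`-adic cycle class map
  `CH^i(X) ⊗ ℚ_l → H^{2i}(X̄, ℚ_l(i))^G` … «Ceci est un cas particulier de deux conjectures
  fondamentales en géométrie arithmétique : la conjecture de Tate [61] (surjectivité de (∗)) et la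
  conjecture de Beilinson [3, 1.0] (injectivité de (∗)).»
* p. 978, DÉFINITION 1: «a) Soit `B(k)` l'ensemble des classes d'isomorphismes de k-variétés
  projectives lisses dont le motif de Chow est dans la sous-catégorie épaisse rigide `A_ab` de `A`
  engendrée par les motifs d'Artin et les motifs de variétés abéliennes (ou de courbes, c'est la
  même chose). On dit que `X` est de type abélien si `X ∈ B(k)`. b) Soit `B_tate(k) ⊂ B(k)` le
  sous-ensemble des variétés `X` vérifiant la conjecture de Tate (pour un nombre premier `l ≠ p`
  donné : cela ne dépend pas de `l`, cf. [62, Th. 2.9] puisque Frobenius opère de manière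
  semi-simple sur la cohomologie l-adique de `X`, voir lemme 1.9 ci-dessous).»
  Exemples 1 c): «Milne a démontré que la conjecture de Hodge pour les variétés abéliennes
  complexes de type CM implique la conjecture de Tate pour les variétés abéliennes sur `k` [51].»
  ([51] = Milne 1999.)
* p. 978, «THÉORÈME 1 (cf. th. 1.10). – Pour tout `X ∈ B_tate(k)`, l'équivalence rationnelle est
  égale à l'équivalence numérique (à coefficients rationnels) sur `X`.»
* p. 982, LEMME 1.9: «Pour tout `M ∈ A_ab`, l'action de Frobenius sur `H_l(M)` est semi-simple.»;
  THÉORÈME 1.10 (with `X′ = Spec k`: `CH^{dim X + n}(X) ⊗ ℚ → A_num^{dim X + n}(X) ⊗ ℚ` is an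
  isomorphism for every `n ∈ ℤ`); proof: «D'après le théorème 1.4 [Kimura], `h(X)(n) ∈ A_kim`. En
  tenant compte du lemme 1.9, on déduit de [63, th. 2.9] que l'équivalence homologique et
  l'équivalence numérique coïncident sur `X`. […]».
* p. 982, «COROLLAIRE 2.1. – Soit `X ∈ B_tate(k)`. Alors, pour tout `n`, l'ordre du pôle de la
  fonction zêta `ζ(X, s)` en `s = n` est égal au rang de `CH^n(X)` (qui est fini d'après le
  théorème 1.10).  Démonstration. – Un cas particulier du théorème 1.10 est que, sur `X`,
  l'équivalence homologique (relative à toute cohomologie de Weil) est égale à l'équivalence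
  numérique. L'énoncé résulte donc du théorème 1.10 et de [63, th. 2.9].» ([63] = Tate 1994.)
* p. 991, in the restatement of Lichtenbaum's conjectures: «7. `m(n)` est l'ordre du pôle de la
  fonction `Z(X, t)` en `t = q^{−n}` (`ζ(X, s) = Z(X, q^{−s})`).» — the dictionary between the
  `s`- and the `t`-variable used below (`t = q^{-s}` is a local analytic isomorphism at `s = n`, so
  the two pole orders agree).
* The same statement in Milne's notation — J. S. Milne, *Addendum to: Values of zeta functions of
  varieties over finite fields*, Amer. J. Math. 137 (2015) = arXiv:1210.7460
  [Milne2012AddendumZetaValues], §0.4: «`X` is a smooth projective variety over a finite field `k`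
  with `q` elements, `r` is an integer, and `ρ_r` is the rank of the group of numerical equivalence
  classes of algebraic cycles of codimension `r` on `X`. […] `T^r(X)` (Tate conjecture): The order
  of the pole of the zeta function `Z(X, t)` at `t = q^{−r}` is equal to `ρ_r`. `T^r(X, l)`
  (l-Tate conjecture): The map `CH^r(X) ⊗ ℚ_l → H^{2r}(X̄_ét, ℚ_l(r))^Γ` is surjective. […] The
  statement `T^r(X)` is implied by the conjunction of `T^r(X, l)`, `T^{d−r}(X, l)`, and
  `S^r(X, l)` for a single `l`, and implies `T^r(X, l)`, `T^{d−r}(X, l)`, `S^r(X, l)`,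
  `S^{d−r}(X, l)` for all `l` (see [tate1994], 2.9; [milne2007aim], 1.11).»; and Milne, *The Tate
  conjecture over finite fields (AIM talk)*, arXiv:0709.3040 [Milne2007TateFiniteFieldsAIM],
  Thm. 1.2 (folklore; «The proof is explained in [tate1994], 2»): `T^r(X, ℓ)` and `E^r(X, ℓ)` for
  a single `ℓ` ⟺ … ⟺ «the order of the pole of the zeta function `Z(X, t)` at `t = q^{−r}` is
  equal to the rank of the group of numerical equivalence classes of algebraic cycles of
  codimension `r`».  Tate 1994 (PSPM 55) Thm. 2.9 itself is NOT held by the hub (no open copy);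
  it is quoted here only through Kahn and Milne.
* A REFEREED FIRST-HAND LOCUS of the same package of implications (read 2026-08-20 from the
  author's scan `https://www.jmilne.org/math/articles/1986a.pdf`, an image-only CCITT scan rendered
  page by page; documentary only — nothing below is typed from it): J. S. Milne, *Values of zeta
  functions of varieties over finite fields*, Amer. J. Math. 108 (1986) 297–360
  [Milne1986ValuesZetaFunctionsFiniteFields], §8 «Complements on Tate's conjecture» (pp. 345–348;
  «In this section, `X` will be projective and `k` finite»).  p. 345: «`B^r_ℓ(X) = c^r_ℓ(CH^r(X))ℚ_ℓ`
  = subspace of `H^{2r}(X̄, ℚ_ℓ(r))` generated by algebraic cycles. We shall need to consider two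
  forms of Tate's conjecture [36]. `T′(X, r, ℓ)`: `B^r_ℓ(X) = H^{2r}(X̄, ℚ_ℓ(r))^Γ`. `T(X, r, ℓ)`: the
  dimension of `B^r_ℓ(X)` is the multiplicity of `q^r` as an inverse root of `P_{2r}(X, t)`. […]
  `SS(X, r, ℓ)`: 1 is not a multiple root of the minimal polynomial of `γ` acting on
  `H^{2r}(X̄, ℚ_ℓ(r))`.»; p. 346: «PROPOSITION 8.2. For all `r` and `ℓ`,
  `T(X, r, ℓ) ⟺ (T′(X, r, ℓ) and SS(X, r, ℓ))`.», «COROLLARY 8.3. For all `r` and `ℓ`,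
  `(T′(X, r, ℓ) and T(X, d − r, ℓ)) ⟹ T(X, r, ℓ)`.», «PROPOSITION 8.4. There are the following
  implications: `(T′(X, r, ℓ) and CH^r_ℓ(X) = CH^r_num(X)) ⟹ T(X, d − r, ℓ) ⟹ CH^r_ℓ(X) = CH^r_num(X)`.»
  (`CH^r_ℓ(X) = Ker(c^r_ℓ)`, `CH^r_num(X) = {Z | Z·Z′ = 0 all Z′ ∈ CH^{d−r}(X)}`, p. 345); p. 348:
  «Remark 8.6. […] `T(X × X, ℓ, d)` implies `γ` acts semisimply on the cohomology groups
  `H^i(X̄, ℚ_ℓ(r))` (for `ℓ ≠ p`, this is equivalent to `φ` acting semisimply on `H^i(X̄, ℚ_ℓ)`). In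
  particular we see that if `T(X, ℓ, r)` holds for all `X` and `r`, then `φ` acts semisimply on
  `H^i(X̄, ℚ_ℓ)` for all `i`, and `CH^r_ℓ(X) = CH^r_num(X)` for all `r` and `X`.»  (Milne 1994,
  *Motives over finite fields*, PSPM 55.1, Prop. 1.15 cites exactly «(Tate 1992, 2.9; Milne 1986,
  8.6)» for «Tate ⟹ cycle map isomorphism onto the Galois invariants + `π_V` acts semisimply».)
  In this paper's notation `T(X, r, ℓ)` is the pole-order (multiplicity) form used by COROLLAIRE 2.1
  above and `T′` the cycle-span form `T^r(X, l)` of [Milne2012AddendumZetaValues] §0.4.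

## Lean rendering

* **Order of a pole** of a power series `Z ∈ ℚ⟦T⟧` at `t = t₀` (`HasPoleOfOrderAt Z t₀ ρ`): in the
  tree's polynomial-presentation style for rational functions (`Motives.HasFunctionalEquation`,
  `Motives.IsWeilFactorization`: no evaluation of rational functions, hence no junk values at
  poles) — there are polynomials `A, B ∈ ℚ[T]`, BOTH NON-VANISHING AT `t₀`, with
  `Z · B · (T − t₀)^ρ = A` in `ℚ⟦T⟧`; i.e. `Z = A / (B (T − t₀)^ρ)` is (the expansion of) a
  rational function whose order at `t₀` is exactly `−ρ`. The exponent is unique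
  (`HasPoleOfOrderAt.unique`, proved); for `ρ = 0` the predicate says "regular and non-zero at
  `t₀`", which is the printed meaning in every instance below (the rank is `≥ 1`).
* **`X ∈ B_tate(k)` at an abelian variety `A/k`** (`InBTate E A`): an abelian variety is «de type
  abélien» by Déf. 1 a) (its Chow motive generates `A_ab`), so for `X = A` membership in
  `B_tate(k)` is exactly «vérifiant la conjecture de Tate» = surjectivity of (∗) for all `i ≥ 0` at
  the given `l` = the tree's `E.TateConjectureFor A.X i` for all `i` (`Motives/GaloisRealization`:
  the `ℚ_l`-span of the classes of `k`-rational codimension-`i` cycles is the whole of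
  `(H^{2i}(A_{k̄})(i))^{Gal}`) — VERBATIM the first conjunct of `Milne1999.TateStatement01 E` at
  `(k, ℓ, A, i)`.
* **Théorème 1 at `A`** (`RationalEqNumerical W A`, `Theoreme1 E`): «l'équivalence rationnelle est
  égale à l'équivalence numérique (à coefficients rationnels)»: every `d`-cycle on `A`
  (`d + n = dim A`) that is numerically trivial — the tree's `W.IsNumericallyTrivial`
  (`Motives/WeilCohomology`, Kleiman §3.1: `tr(γ(c) ∪ γ(c′)) = 0` for all `c′`, the intersection
  numbers computed in the Weil cohomology `W`; Kahn, proof of Cor. 2.1: «relative à toute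
  cohomologie de Weil») — has TORSION class in the Chow group `CH_d(A) = Motives.ChowGroup`
  (Mathlib `IsOfFinAddOrder`), i.e. vanishes in `CH_d(A) ⊗ ℚ`. The converse inclusion (torsion
  classes, in particular rationally trivial cycles, are numerically trivial) is PROVED for every
  Weil cohomology and every smooth projective `X` (`isNumericallyTrivial_of_isOfFinAddOrder`), so
  the record states exactly the printed EQUALITY's content.
* **Corollaire 2.1 at `A`** (`Corollaire21 E`): for `0 ≤ n ≤ dim A`, written `n + d = dim A` (the
  Chow groups of the tree are indexed by dimension, `CH^n(A) = CH_d(A)`): the rank of the abelian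
  group `CH_d(A)` — Mathlib's `Module.rank ℤ`, the torsion-free rank — is FINITE, `= ρ`, and
  `Z(A, t) = Motives.zetaSeries A.X` (defined from the point counts `#A(𝔽_{q^m})`,
  `Motives/ZetaFunction`) has a pole of order exactly `ρ` at `t = q^{-n}`, `q = Nat.card k`
  (Kahn's `ζ(X, s)` at `s = n`, by his own dictionary p. 991 item 7).
  `-- TODO(general form):` Kahn's `X ∈ B_tate(k)` ranges over all varieties of abelian type
  (products of curves, Fermat hypersurfaces with `q^ν ≡ −1 mod m`, …) and «pour tout `n`» includes
  `n < 0`, `n > dim X` (where `CH^n = 0` and `Z` has no pole); the tree has no category of Chow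
  motives `A_ab`, so only the case of an abelian variety and `0 ≤ n ≤ dim A` is typed.
* **Standing.** `Theoreme1 E` and `Corollaire21 E` are `E`-parametrised cited PREDICATES:
  theorems in print at the intended `E k ℓ :=` `ℓ`-adic étale cohomology of varieties over the
  finite field `k` with its Galois action and cycle classes, NOT asserted for arbitrary data of
  type `GaloisWeilCohomology` — the standing of `Milne1999.Theorem71 E`,
  `MilneRamachandran2006.Theorem110 E`, `Motives.TateImpliesHodgeAbelianStatement E B` (ruled
  predicates 2026-08-15). No `_holds` is owed or claimed.
* **The edges.** `inBTate_of_HC_CM`: HC for all complex CM abelian varieties ⟹ (Thm. 7.1) every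
  abelian variety over every finite field lies in `B_tate(k)` (for every `ℓ ≠ p`).
  `rationalEqNumerical_AV_Fq_of_HC_CM`, `zetaPoleOrder_AV_Fq_of_HC_CM` (the prime `ℓ ≠ char k` at
  which Kahn's hypothesis is fed is CHOSEN inside the proof, so the conclusion mentions no `ℓ` and
  no cohomology), `rank_chowGroup_finite_AV_Fq_of_HC_CM`.

## Sanity of the conventions (not formalised; unconditional in print)

For an elliptic curve `A/𝔽_q` (`dim A = 1`), `Z(A, t) = (1 − a t + q t²)/((1 − t)(1 − q t))`
with `|a| ≤ 2√q` (Weil): at `n = 0` (`d = 1`), `Z` has a simple pole at `t = 1 = q⁰` and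
`CH_1(A) = CH⁰(A) = ℤ · [A]` has rank `1`; at `n = 1` (`d = 0`), `Z` has a simple pole at
`t = q⁻¹` (the numerator does not vanish there since `|a| ≤ 2√q < q + 1`) and
`CH_0(A) = Pic(A) = ℤ ⊕ A(𝔽_q)` has rank `1`. Both instances of `Corollaire21` hold, as they must
(Tate's theorem for divisors on abelian varieties); they fix the indexing (`t₀ = q^{-n}`,
`CH^n = CH_{dim A − n}`) used below.

## References

* [KahnB2003RatNumAbelianType] B. Kahn, Ann. Sci. ÉNS (4) 36 (2003) 977–1002: (∗) p. 977; Déf. 1,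
  Exemples 1, Thm. 1 p. 978; Lemme 1.9, Thm. 1.10, Cor. 2.1 p. 982; p. 991 item 7.
* [Milne2012AddendumZetaValues] J. S. Milne, Amer. J. Math. 137 (2015) 1703–1712 = arXiv:1210.7460,
  §0.4 (`T^r(X)`, `T^r(X, l)`, `S^r(X, l)`, `ρ_r`).
* [Milne2007TateFiniteFieldsAIM] J. S. Milne, The Tate conjecture over finite fields (AIM talk),
  arXiv:0709.3040, §1, Thm. 1.2.
* [Milne1999] J. S. Milne, Compositio Math. 117 (1999), Thm. 7.1 p. 72 (`Milne1999.Theorem71`).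
* [TateMotives1994] J. Tate, Conjectures on algebraic cycles in ℓ-adic cohomology, PSPM 55 (1994),
  Thm. 2.9 — second-hand (through Kahn and Milne).
* [Milne1986ValuesZetaFunctionsFiniteFields] J. S. Milne, Values of zeta functions of varieties over
  finite fields, Amer. J. Math. 108 (1986) 297–360, §8 pp. 345–348: `T′`/`T`/`SS` (p. 345),
  Prop. 8.2, Cor. 8.3, Prop. 8.4 (pp. 346–347), Rem. 8.6 (p. 348) — first-hand (author's scan,
  rendered 2026-08-20); documentary.
-/

noncomputable section

open CategoryTheory AlgebraicGeometry Polynomial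

namespace Literature.AlgebraicGeometry.Kahn2003

open Literature.AlgebraicGeometry.Motives
open Literature.AlgebraicGeometry.Milne1999

universe u v

/-! ### The order of the pole of a power series at a point -/

/-- **`Z` has a pole of order exactly `ρ` at `t = t₀`** («l'ordre du pôle de la fonction zêta …
est égal au rang», Kahn Cor. 2.1; «The order of the pole of the zeta function `Z(X, t)` at
`t = q^{-r}`», Milne 2015 §0.4 `T^r(X)`), for a formal power series `Z ∈ ℚ⟦T⟧` that is (the
expansion of) a rational function: there are polynomials `A, B ∈ ℚ[T]` with `A(t₀) ≠ 0`,
`B(t₀) ≠ 0` and `Z · (B · (T − t₀)^ρ) = A` in `ℚ⟦T⟧` — i.e. `Z = A / (B · (T − t₀)^ρ)` has order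
exactly `−ρ` at `t₀`. Stated, like `Motives.HasFunctionalEquation`, by a polynomial presentation
(no evaluation of rational functions at poles). A definition (nothing is asserted); `ρ` is unique
(`HasPoleOfOrderAt.unique`). [cite: KahnB2003RatNumAbelianType, Cor. 2.1 p. 982]
[cite: Milne2012AddendumZetaValues, §0.4] -/
def HasPoleOfOrderAt (Z : PowerSeries ℚ) (t₀ : ℚ) (ρ : ℕ) : Prop :=
  ∃ A B : ℚ[X], A.eval t₀ ≠ 0 ∧ B.eval t₀ ≠ 0 ∧
    Z * ((B * (X - C t₀) ^ ρ : ℚ[X]) : PowerSeries ℚ) = (A : PowerSeries ℚ)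

/-- Unfolding of `HasPoleOfOrderAt`. [cite: KahnB2003RatNumAbelianType, Cor. 2.1 p. 982] -/
theorem hasPoleOfOrderAt_iff (Z : PowerSeries ℚ) (t₀ : ℚ) (ρ : ℕ) :
    HasPoleOfOrderAt Z t₀ ρ ↔ ∃ A B : ℚ[X], A.eval t₀ ≠ 0 ∧ B.eval t₀ ≠ 0 ∧
      Z * ((B * (X - C t₀) ^ ρ : ℚ[X]) : PowerSeries ℚ) = (A : PowerSeries ℚ) :=
  Iff.rfl

/-- **The order of the pole is well defined**: two presentations
`Z = A / (B (T − t₀)^ρ) = A′ / (B′ (T − t₀)^{ρ′})` with `A, B, A′, B′` non-vanishing at `t₀` have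
`ρ = ρ′` (compare the multiplicity of the root `t₀` in `A B′ (T − t₀)^{ρ′} = A′ B (T − t₀)^ρ`, an
identity of polynomials since `ℚ[T] → ℚ⟦T⟧` is injective). [cite: Milne2012AddendumZetaValues, §0.4] -/
theorem HasPoleOfOrderAt.unique {Z : PowerSeries ℚ} {t₀ : ℚ} {ρ ρ' : ℕ}
    (h : HasPoleOfOrderAt Z t₀ ρ) (h' : HasPoleOfOrderAt Z t₀ ρ') : ρ = ρ' := by
  obtain ⟨A, B, hA, hB, hZ⟩ := h
  obtain ⟨A', B', hA', hB', hZ'⟩ := h'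
  -- cross-multiplied identity of polynomials
  have key : A * (B' * (X - C t₀) ^ ρ') = A' * (B * (X - C t₀) ^ ρ) := by
    apply Polynomial.coe_injective (R := ℚ)
    rw [Polynomial.coe_mul, Polynomial.coe_mul A', ← hZ, ← hZ']
    ring
  have hA0 : A ≠ 0 := fun h0 ↦ hA (by rw [h0, eval_zero])
  have hA0' : A' ≠ 0 := fun h0 ↦ hA' (by rw [h0, eval_zero])
  have hB0 : B ≠ 0 := fun h0 ↦ hB (by rw [h0, eval_zero])
  have hB0' : B' ≠ 0 := fun h0 ↦ hB' (by rw [h0, eval_zero])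
  have hXt : ∀ m : ℕ, (X - C t₀) ^ m ≠ 0 := fun m ↦ pow_ne_zero _ (X_sub_C_ne_zero t₀)
  have hrA : A.rootMultiplicity t₀ = 0 := rootMultiplicity_eq_zero hA
  have hrA' : A'.rootMultiplicity t₀ = 0 := rootMultiplicity_eq_zero hA'
  have hrB : B.rootMultiplicity t₀ = 0 := rootMultiplicity_eq_zero hB
  have hrB' : B'.rootMultiplicity t₀ = 0 := rootMultiplicity_eq_zero hB'
  have h1 : (A * (B' * (X - C t₀) ^ ρ')).rootMultiplicity t₀ = ρ' := by
    rw [rootMultiplicity_mul (mul_ne_zero hA0 (mul_ne_zero hB0' (hXt ρ'))),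
      rootMultiplicity_mul (mul_ne_zero hB0' (hXt ρ')), rootMultiplicity_X_sub_C_pow, hrA, hrB']
    simp
  have h2 : (A' * (B * (X - C t₀) ^ ρ)).rootMultiplicity t₀ = ρ := by
    rw [rootMultiplicity_mul (mul_ne_zero hA0' (mul_ne_zero hB0 (hXt ρ))),
      rootMultiplicity_mul (mul_ne_zero hB0 (hXt ρ)), rootMultiplicity_X_sub_C_pow, hrA', hrB]
    simp
  rw [← h1, ← h2, key]

/-- **Example / sanity check: the shape of `Z(Spec 𝔽_q, T) = 1/(1 − T)`** (Serre, *Zeta and L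
functions* §1; Kahn Cor. 2.1 at the point: `CH⁰` has rank `1`, `ζ` has a simple pole at
`s = 0`): the geometric series `∑ Tᵐ ∈ ℚ⟦T⟧` has a pole of order exactly `1` at `t = 1 = q⁰`
(`(∑ Tᵐ) · (T − 1) = −1`). [cite: KahnB2003RatNumAbelianType, Cor. 2.1 p. 982] -/
theorem hasPoleOfOrderAt_mk_one : HasPoleOfOrderAt (PowerSeries.mk 1) 1 1 := by
  refine ⟨-1, 1, by simp, by simp, ?_⟩
  have h : (PowerSeries.mk 1 : PowerSeries ℚ) * (1 - PowerSeries.X) = 1 :=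
    PowerSeries.mk_one_mul_one_sub_eq_one ℚ
  rw [one_mul, pow_one, map_one, Polynomial.coe_sub, Polynomial.coe_X, Polynomial.coe_one,
    Polynomial.coe_neg, Polynomial.coe_one, show (PowerSeries.X - 1 : PowerSeries ℚ) = -(1 - PowerSeries.X) by ring,
    mul_neg, h]

/-! ### Kahn's class `B_tate(k)`, at an abelian variety -/

section Records

variable {k : Type u} [Field k] {K : Type v} [Field K] [CharZero K]
  {χ : Field.absoluteGaloisGroup k →* Kˣ}

/-- **`A ∈ B_tate(k)`** for an abelian variety `A` over `k`, relative to the Galois Weil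
cohomology `E` (Kahn 2003, Déf. 1 b), p. 978, at `X = A`; the text is quoted verbatim in the
module docstring): an abelian variety is «de type abélien» by Déf. 1 a), so membership in
`B_tate(k)` is surjectivity of the cycle class map (∗) `CH^i(A) ⊗ ℚ_l → H^{2i}(Ā, ℚ_l(i))^G` for
every `i ≥ 0` (p. 977), i.e. Tate's `Tⁱ(A/k)` for every `i` in the tree's rendering
(`Motives/GaloisRealization`: the `K`-span of the classes of `k`-rational codimension-`i` cycles is
the whole Galois-invariant subspace of `H^{2i}(A_{k̄})(i)`) — the first conjunct of
`Milne1999.TateStatement01` at `A`. A predicate on `(E, A)` (a definition, nothing is asserted).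
[cite: KahnB2003RatNumAbelianType, Déf. 1 b) p. 978] -/
def InBTate (E : GaloisWeilCohomology k K χ) (A : AbelianVariety k) : Prop :=
  ∀ i : ℕ, E.TateConjectureFor A.X i

/-- Unfolding of `InBTate`. [cite: KahnB2003RatNumAbelianType, Déf. 1 b) p. 978] -/
theorem inBTate_iff (E : GaloisWeilCohomology k K χ) (A : AbelianVariety k) :
    InBTate E A ↔ ∀ i : ℕ, E.TateConjectureFor A.X i :=
  Iff.rfl

/-! ### Théorème 1: rational = numerical equivalence with `ℚ`-coefficients -/

/-- **«L'équivalence rationnelle est égale à l'équivalence numérique (à coefficients rationnels)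
sur `A`»** (Kahn 2003 Thm. 1 p. 978, the conclusion, at an abelian variety `A` of dimension
`dim A`), the contentful inclusion, relative to the Weil cohomology `W` in which intersection
numbers are computed (proof of Cor. 2.1: «relative à toute cohomologie de Weil»): for
`n + d = dim A`, every `d`-cycle `c` on `A` that is numerically trivial in codimension `n`
(`W.IsNumericallyTrivial`, Kleiman §3.1 — `Motives/WeilCohomology`) has TORSION class in the Chow
group `CH_d(A)` (`Motives.ChowGroup`; Mathlib `IsOfFinAddOrder`: `N • [c] = 0` for some `N ≥ 1`),
i.e. `[c] = 0` in `CH_d(A) ⊗ ℚ`. The converse inclusion is the theorem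
`isNumericallyTrivial_of_isOfFinAddOrder` below. A predicate on `(W, A)` (a definition, nothing
is asserted). [cite: KahnB2003RatNumAbelianType, Thm. 1 p. 978 and Thm. 1.10 p. 982] -/
def RationalEqNumerical (W : WeilCohomology k K) (A : AbelianVariety k) : Prop :=
  ∀ (n d : ℕ), n + d = A.dim → ∀ c : ↥(cyclesOfDim A.X.left d),
    W.IsNumericallyTrivial A.dim A.X n (c : AlgebraicCycle A.X.left ℤ) →
      IsOfFinAddOrder (ChowGroup.mk A.X.left d c)

/-- Unfolding of `RationalEqNumerical`. [cite: KahnB2003RatNumAbelianType, Thm. 1 p. 978] -/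
theorem rationalEqNumerical_iff (W : WeilCohomology k K) (A : AbelianVariety k) :
    RationalEqNumerical W A ↔
      ∀ (n d : ℕ), n + d = A.dim → ∀ c : ↥(cyclesOfDim A.X.left d),
        W.IsNumericallyTrivial A.dim A.X n (c : AlgebraicCycle A.X.left ℤ) →
          IsOfFinAddOrder (ChowGroup.mk A.X.left d c) :=
  Iff.rfl

/-- **The converse inclusion of Théorème 1 is unconditional** (Kleiman 1968 §1.2 (C) / Prop. 3.2
(i); Kahn p. 977: of the two conjectures only Beilinson's injectivity has content in this
direction): for a smooth projective `X` of dimension `m` and `n + d = m`, a `d`-cycle whose class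
in `CH_d(X)` is torsion is numerically trivial in codimension `n` for EVERY Weil cohomology `W` —
`N • c` is rationally trivial, so `γ(N • c) = N • γ(c) = 0` (`W.cycleMap_eq_zero_of_mem_ratTrivial`),
hence `γ(c) = 0` (`char K = 0`) and `c` is homologically, a fortiori numerically, trivial. The
instance hypothesis `[CompactSpace X.left]` is the tree's named fact `IsSmoothProjective.compactSpace`.
[cite: KahnB2003RatNumAbelianType, Thm. 1 p. 978] [cite: Kleiman1968, §1.2 (C) and Prop. 3.2 (i)] -/
theorem isNumericallyTrivial_of_isOfFinAddOrder (W : WeilCohomology k K) {m : ℕ} {X : SchemeOver k}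
    (hX : IsSmoothProjective m X) [CompactSpace X.left] {n d : ℕ} (h : n + d = m)
    (c : ↥(cyclesOfDim X.left d)) (hc : IsOfFinAddOrder (ChowGroup.mk X.left d c)) :
    W.IsNumericallyTrivial m X n (c : AlgebraicCycle X.left ℤ) := by
  obtain ⟨N, hN, hNc⟩ := (isOfFinAddOrder_iff_nsmul_eq_zero).mp hc
  refine W.isNumericallyTrivial_of_isHomologicallyTrivial ?_
  -- `N • c` is rationally trivial
  have hmem : ((N • c : ↥(cyclesOfDim X.left d)) : AlgebraicCycle X.left ℤ) ∈ ratTrivial X.left d := by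
    have h0 : ChowGroup.mk X.left d (N • c) = 0 := by rw [map_nsmul, hNc]
    have := (QuotientAddGroup.eq_zero_iff _).mp h0
    exact AddSubgroup.mem_addSubgroupOf.mp this
  have hγN : W.cycleMap X n ((N • c : ↥(cyclesOfDim X.left d)) : AlgebraicCycle X.left ℤ) = 0 :=
    W.cycleMap_eq_zero_of_mem_ratTrivial hX n d h _ hmem
  have hγ : (N : K) • W.cycleMap X n (c : AlgebraicCycle X.left ℤ) = 0 := by
    have : W.cycleMap X n ((N • c : ↥(cyclesOfDim X.left d)) : AlgebraicCycle X.left ℤ) =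
        N • W.cycleMap X n (c : AlgebraicCycle X.left ℤ) := by
      rw [AddSubgroup.coe_nsmul]
      exact map_nsmul (W.cyclesOfDimCycleMap n d) N c
    rw [this, ← Nat.cast_smul_eq_nsmul K] at hγN
    exact hγN
  have hNK : (N : K) ≠ 0 := Nat.cast_ne_zero.mpr hN.ne'
  exact (smul_eq_zero.mp hγ).resolve_left hNK

/-- **Kahn 2003, THÉORÈME 1 (= Thm. 1.10), for abelian varieties over finite fields** — a THEOREM
in print (p. 978: «Pour tout `X ∈ B_tate(k)`, l'équivalence rationnelle est égale à l'équivalence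
numérique (à coefficients rationnels) sur `X`»; proof p. 982 via Kimura's finite-dimensionality of
the motive of `A` (Thm. 1.4), the semisimplicity of Frobenius (Lemme 1.9, Weil) and Tate 1994
Thm. 2.9), relative to `ℓ`-adic data `E k ℓ` for every finite field `k` and prime `ℓ ≠ char k`:
for every abelian variety `A/k`, if `A ∈ B_tate(k)` at `ℓ` (`InBTate`) then rational and
numerical equivalence agree on `A` with `ℚ`-coefficients (`RationalEqNumerical`). An
`E`-parametrised cited PREDICATE — Kahn's theorem at the intended `E` (étale cohomology with its
Galois action and cycle classes), not asserted for arbitrary data of that type; the standing of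
`Milne1999.Theorem71`. `-- TODO(general form): X ∈ B_tate(k)` of abelian type, not only abelian
varieties. [cite: KahnB2003RatNumAbelianType, Thm. 1 p. 978 and Thm. 1.10 p. 982] -/
def Theoreme1
    (E : ∀ (k : Type) [Field k] [Finite k] (ℓ : ℕ) [Fact ℓ.Prime] [NeZero (ℓ : k)],
      GaloisWeilCohomology k ℚ_[ℓ] (padicCyclotomicCharacter k ℓ)) : Prop :=
  ∀ (k : Type) [Field k] [Finite k] (ℓ : ℕ) [Fact ℓ.Prime] [NeZero (ℓ : k)]
    (A : AbelianVariety k), InBTate (E k ℓ) A → RationalEqNumerical (E k ℓ).toWeilCohomology A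

/-! ### Corollaire 2.1: the order of the pole of `Z(A, t)` at `t = q^{-n}` is the rank of `CH^n(A)` -/

/-- **Kahn 2003, COROLLAIRE 2.1, for abelian varieties over finite fields** — a THEOREM in print
(p. 982: «Soit `X ∈ B_tate(k)`. Alors, pour tout `n`, l'ordre du pôle de la fonction zêta `ζ(X, s)`
en `s = n` est égal au rang de `CH^n(X)` (qui est fini d'après le théorème 1.10)»; `ζ(X, s) =
Z(X, q^{-s})`, p. 991 item 7), relative to `ℓ`-adic data `E k ℓ`: for every finite field `k` with
`q = Nat.card k` elements, every prime `ℓ ≠ char k`, every abelian variety `A/k` with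
`A ∈ B_tate(k)` at `ℓ`, and every `0 ≤ n ≤ dim A` (written `n + d = dim A`, `CH^n(A) = CH_d(A)`):
the rank of the abelian group `CH_d(A) = Motives.ChowGroup A.X.left d` (Mathlib `Module.rank ℤ`)
is finite, equal to some `ρ : ℕ`, and the zeta function `Z(A, t) = Motives.zetaSeries A.X ∈ ℚ⟦t⟧`
(built from the point counts `#A(𝔽_{q^m})`) has a pole of order exactly `ρ` at `t = q^{-n}`
(`HasPoleOfOrderAt`). An `E`-parametrised cited PREDICATE in the standing of `Theoreme1` /
`Milne1999.Theorem71`; its conclusion mentions no cohomology. `-- TODO(general form):` all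
`X ∈ B_tate(k)` of abelian type and all `n ∈ ℤ`. [cite: KahnB2003RatNumAbelianType, Cor. 2.1 p. 982]
[cite: Milne2012AddendumZetaValues, §0.4] -/
def Corollaire21
    (E : ∀ (k : Type) [Field k] [Finite k] (ℓ : ℕ) [Fact ℓ.Prime] [NeZero (ℓ : k)],
      GaloisWeilCohomology k ℚ_[ℓ] (padicCyclotomicCharacter k ℓ)) : Prop :=
  ∀ (k : Type) [Field k] [Finite k] (ℓ : ℕ) [Fact ℓ.Prime] [NeZero (ℓ : k)]
    (A : AbelianVariety k), InBTate (E k ℓ) A →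
      ∀ (n d : ℕ), n + d = A.dim →
        ∃ ρ : ℕ, Module.rank ℤ (ChowGroup A.X.left d) = ρ ∧
          HasPoleOfOrderAt (zetaSeries A.X) (((Nat.card k : ℚ) ^ n)⁻¹) ρ

end Records

/-! ### The kernel-visible edges from `HC_CM` -/

section Edges

variable {E : ∀ (k : Type) [Field k] [Finite k] (ℓ : ℕ) [Fact ℓ.Prime] [NeZero (ℓ : k)],
  GaloisWeilCohomology k ℚ_[ℓ] (padicCyclotomicCharacter k ℓ)}

/-- **`HC_CM` ⟹ every abelian variety over every finite field lies in Kahn's `B_tate(k)`** (for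
every `ℓ ≠ char k`): Milne 1999 Thm. 7.1 gives Tate's `T^i(A/k, ℓ)` for all `i` (the first
conjunct of (0.1) per model), which is Déf. 1 b) at `A` — Kahn's own Exemples 1 c): «Milne a
démontré que la conjecture de Hodge pour les variétés abéliennes complexes de type CM implique la
conjecture de Tate pour les variétés abéliennes sur `k`». [cite: KahnB2003RatNumAbelianType, Déf. 1 b) and Exemples 1 c) p. 978]
[cite: Milne1999, Thm. 7.1 p. 72] -/
theorem inBTate_of_HC_CM (h71 : Theorem71 E) (hHC : ∀ A : AbelianVariety ℂ, CMHodgeHypothesisAt A)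
    (k : Type) [Field k] [Finite k] (ℓ : ℕ) [Fact ℓ.Prime] [NeZero (ℓ : k)]
    (A : AbelianVariety k) : InBTate (E k ℓ) A :=
  fun i ↦ (h71 hHC k ℓ A i).1

/-- **The edge `HC_CM` ⟹ rational = numerical equivalence (`ℚ`-coefficients) on every abelian
variety over every finite field**, by name: modus ponens through Milne 1999 Thm. 7.1
(`Theorem71 E`) and Kahn 2003 Thm. 1 (`Theoreme1 E`) at the `ℓ`-adic data `E`.
[cite: KahnB2003RatNumAbelianType, Thm. 1 p. 978] [cite: Milne1999, Thm. 7.1 p. 72] -/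
theorem rationalEqNumerical_AV_Fq_of_HC_CM (h71 : Theorem71 E) (h1 : Theoreme1 E)
    (hHC : ∀ A : AbelianVariety ℂ, CMHodgeHypothesisAt A)
    (k : Type) [Field k] [Finite k] (ℓ : ℕ) [Fact ℓ.Prime] [NeZero (ℓ : k)]
    (A : AbelianVariety k) : RationalEqNumerical (E k ℓ).toWeilCohomology A :=
  h1 k ℓ A (inBTate_of_HC_CM h71 hHC k ℓ A)

/-- Over a finite field there is a prime `ℓ` invertible in `k` (any prime other than the
characteristic), so that Kahn's hypothesis «pour un nombre premier `l ≠ p` donné» can be fed at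
some `ℓ`. [cite: KahnB2003RatNumAbelianType, Déf. 1 b) p. 978] -/
private theorem exists_prime_cast_ne_zero (k : Type u) [Field k] [Finite k] :
    ∃ ℓ : ℕ, ℓ.Prime ∧ (ℓ : k) ≠ 0 := by
  obtain ⟨p, hp⟩ := CharP.exists k
  have hp0 : p ≠ 0 := CharP.char_ne_zero_of_finite k p
  have hpp : p.Prime := (CharP.char_is_prime_or_zero k p).resolve_right hp0
  obtain ⟨ℓ, hle, hℓ⟩ := Nat.exists_infinite_primes (p + 1)
  refine ⟨ℓ, hℓ, fun h ↦ ?_⟩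
  have hdvd : p ∣ ℓ := (CharP.cast_eq_zero_iff k p ℓ).mp h
  have := (Nat.prime_dvd_prime_iff_eq hpp hℓ).mp hdvd
  omega

/-- **The edge `HC_CM` ⟹ for every abelian variety `A` over every finite field `𝔽_q` and every
`0 ≤ n ≤ dim A`, the Chow group `CH^n(A) = CH_d(A)` (`n + d = dim A`) has FINITE rank `ρ` and the
zeta function `Z(A, t)` has a pole of order exactly `ρ` at `t = q^{-n}`** — by name: Milne 1999
Thm. 7.1 (`Theorem71 E`) puts `A` in `B_tate(k)` at a prime `ℓ ≠ char k` chosen here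
(`exists_prime_cast_ne_zero`), and Kahn 2003 Cor. 2.1 (`Corollaire21 E`) at the `ℓ`-adic data `E`
concludes. The conclusion is intrinsic to `A/𝔽_q`: point counts and Chow groups only.
[cite: KahnB2003RatNumAbelianType, Cor. 2.1 p. 982] [cite: Milne1999, Thm. 7.1 p. 72] -/
theorem zetaPoleOrder_AV_Fq_of_HC_CM (h71 : Theorem71 E) (h21 : Corollaire21 E)
    (hHC : ∀ A : AbelianVariety ℂ, CMHodgeHypothesisAt A)
    (k : Type) [Field k] [Finite k] (A : AbelianVariety k) {n d : ℕ} (h : n + d = A.dim) :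
    ∃ ρ : ℕ, Module.rank ℤ (ChowGroup A.X.left d) = ρ ∧
      HasPoleOfOrderAt (zetaSeries A.X) (((Nat.card k : ℚ) ^ n)⁻¹) ρ := by
  obtain ⟨ℓ, hℓ, hℓk⟩ := exists_prime_cast_ne_zero k
  haveI : Fact ℓ.Prime := ⟨hℓ⟩
  haveI : NeZero (ℓ : k) := ⟨hℓk⟩
  exact h21 k ℓ A (inBTate_of_HC_CM h71 hHC k ℓ A) n d h

/-- First projection of the pole-order edge: **`HC_CM` ⟹ the Chow groups of every abelian variety
over every finite field have finite rank** (`CH_d(A) ⊗ ℚ` is finite-dimensional for every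
`d ≤ dim A`; Kahn Cor. 2.1 «qui est fini d'après le théorème 1.10»).
[cite: KahnB2003RatNumAbelianType, Cor. 2.1 p. 982] -/
theorem rank_chowGroup_finite_AV_Fq_of_HC_CM (h71 : Theorem71 E) (h21 : Corollaire21 E)
    (hHC : ∀ A : AbelianVariety ℂ, CMHodgeHypothesisAt A)
    (k : Type) [Field k] [Finite k] (A : AbelianVariety k) {n d : ℕ} (h : n + d = A.dim) :
    ∃ ρ : ℕ, Module.rank ℤ (ChowGroup A.X.left d) = ρ :=
  let ⟨ρ, hρ, _⟩ := zetaPoleOrder_AV_Fq_of_HC_CM h71 h21 hHC k A h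
  ⟨ρ, hρ⟩

/-- The order of the pole of `Z(A, t)` at `t = q^{-n}` delivered by the edge is THE rank of
`CH_d(A)`: any exponent `ρ′` with `HasPoleOfOrderAt (Z(A, t)) q^{-n} ρ′` equals the rank
(uniqueness of the pole order). [cite: KahnB2003RatNumAbelianType, Cor. 2.1 p. 982] -/
theorem rank_chowGroup_eq_of_hasPoleOfOrderAt_of_HC_CM (h71 : Theorem71 E) (h21 : Corollaire21 E)
    (hHC : ∀ A : AbelianVariety ℂ, CMHodgeHypothesisAt A)
    (k : Type) [Field k] [Finite k] (A : AbelianVariety k) {n d : ℕ} (h : n + d = A.dim)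
    {ρ' : ℕ} (hρ' : HasPoleOfOrderAt (zetaSeries A.X) (((Nat.card k : ℚ) ^ n)⁻¹) ρ') :
    Module.rank ℤ (ChowGroup A.X.left d) = ρ' := by
  obtain ⟨ρ, hρ, hZ⟩ := zetaPoleOrder_AV_Fq_of_HC_CM h71 h21 hHC k A h
  rw [hρ, hZ.unique hρ']

end Edges

end Literature.AlgebraicGeometry.Kahn2003

end
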